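import Mathlib
import Summits.CriticalPhenomena.CardyFormulaZ2.Theorems.CardySelfRefinementDefs
import Summits.CriticalPhenomena.CardyFormulaZ2.Theorems.CardySelfRefinementTrivialSectorRateStubLocalEngineRotation
import Summits.CriticalPhenomena.CardyFormulaZ2.Theorems.CardySelfRefinementTrivialSectorRateStubOrbitAlignmentConditioning
import Literature.Probability.Percolation.SelfRefinementMeasure
import HarnessLib

/-!
# Stub `stub_localEngine` of line `far-field-is-a-quarter-turn` (crux `TrivialSectorRate`,
stmt-CriticalPhenomena-10266): the quarter turn CONDITIONALLY on the far field

Companion of `…TrivialSectorRateStubLocalEngineRotation.lean` (intertwined pairs `(g, σ)`, the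
quarter turn `g` about `ctr k u = k•u` and its bias-preserving coin permutation `σ`, pinned down by
their formulas).  The engine `stub_localEngine` is stated for the law `ν_K = coinLaw ∘ (· ∩ K)⁻¹`
of the coins inside a window `K`, the coins outside being frozen to a condition `S₁`
(`…StubOrbitAlignmentConditioning.lean`).  Here the coin-level transport of
`…StubLocalEngineRotation.lean` is carried over to this conditional currency:

* `coinLaw_map_inter_map_pullback`: `(ν_K).map (σ ⁻¹' ·) = ν_{σ ⁻¹' K}` (the pull-back commutes
  with the restriction up to transporting the window), hence `ν_K {T | σ ⁻¹' T ∈ Y} = ν_{σ⁻¹K} (Y)`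
  for EVERY `Y` (`condLaw_real_pullback`; no measurability, the pull-back is a measurable
  equivalence);
* the three shapes of the engine — plain, coin forced on, coin forced off — for a pulled-back coin
  event `{S | σ ⁻¹' S ∈ X}`: window `K ↦ σ ⁻¹' K`, condition `S₁ ↦ σ ⁻¹' S₁`, coin `i ↦ σ⁻¹ i`
  (`cond_real_pullback`, `cond_real_insert_pullback`, `cond_real_diff_pullback`);
* for the quarter turn about `k•u` and ANY event `B` of bond configurations: the conditional
  signed influence of the coin `i` on the coin event of the rotated event `{ω | g '' ω ∈ B}`, window
  `K`, condition `S₁`, equals that of `σ⁻¹ i` on the coin event of `B`, window `σ ⁻¹' K`, condition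
  `σ ⁻¹' S₁` (`cond_infl_quarterTurn`, registered), together with `quarterTurn_ctr` (`g` fixes the
  block centre) and `coinLaw_map_preimage_quarterTurn`.

Caveat for the user: the coin window `coinWindow k (boxEdgesAt (ctr k u) R)` of the engine is
`σ`-invariant only when `k ∣ R` (the over-approximating `coinsOf` attaches to a non-axial edge the
bundle coins of its cell base, whose rotated label is one coarse step off near the box boundary).
-/

noncomputable section

namespace Summit.CriticalPhenomena.CardyFormulaZ2.Theorems.CardySelfRefinement.FarField

open Set MeasureTheory
open Literature.Probability.LatticeModels Literature.Probability.Percolation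
open Literature.Probability.Percolation.QuadCrossing
open Summit.CriticalPhenomena.CardyFormulaZ2.Theses.CardySelfRefinement

/-! ### Conditional laws transport along a bias-preserving coin permutation -/

/-- The pull-back along `σ` commutes with the restriction to a coin window, up to transporting the
window: `(ν_K).map (σ ⁻¹' ·) = ν_{σ ⁻¹' K}` for `ν_K = coinLaw ∘ (· ∩ K)⁻¹`, `σ` bias-preserving. -/
theorem coinLaw_map_inter_map_pullback (k : ℕ) (q : ℝ × ℝ) (σ : Coin ≃ Coin)
    (hprm : ∀ i, prm k q.1 q.2 (σ i) = prm k q.1 q.2 i) (K : Set Coin) :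
    ((coinLaw k q).map (fun T : Set Coin => T ∩ K)).map (fun S : Set Coin => σ ⁻¹' S) =
      (coinLaw k q).map (fun T : Set Coin => T ∩ σ ⁻¹' K) := by
  rw [Measure.map_map (measurable_preimage_coin σ) (measurable_inter_right K),
    show (fun S : Set Coin => σ ⁻¹' S) ∘ (fun T : Set Coin => T ∩ K) =
      (fun T : Set Coin => T ∩ σ ⁻¹' K) ∘ (fun S : Set Coin => σ ⁻¹' S) from
        funext fun T => Set.preimage_inter,
    ← Measure.map_map (measurable_inter_right _) (measurable_preimage_coin σ),
    coinLaw_map_preimage k q σ hprm]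

/-- **Conditional laws transport along `σ`**: `ν_K {T | σ ⁻¹' T ∈ Y} = ν_{σ ⁻¹' K} (Y)` for EVERY
`Y` (the pull-back is a measurable equivalence). -/
theorem condLaw_real_pullback (k : ℕ) (q : ℝ × ℝ) (σ : Coin ≃ Coin)
    (hprm : ∀ i, prm k q.1 q.2 (σ i) = prm k q.1 q.2 i) (K : Set Coin) (Y : Set (Set Coin)) :
    ((coinLaw k q).map (fun T : Set Coin => T ∩ K)).real ((fun S : Set Coin => σ ⁻¹' S) ⁻¹' Y) =
      ((coinLaw k q).map (fun T : Set Coin => T ∩ σ ⁻¹' K)).real Y := by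
  have h := MeasurableEquiv.map_apply (μ := (coinLaw k q).map (fun T : Set Coin => T ∩ K))
    (SiteConfig.relabel σ.symm) Y
  rw [coe_relabel_symm_eq_preimage, coinLaw_map_inter_map_pullback k q σ hprm K] at h
  rw [measureReal_def, measureReal_def, h]

/-- Conditional probability of a pulled-back coin event, condition `S₁` off the window `K`:
`ν_K {T | T ∪ (S₁ \ K) ∈ (σ ⁻¹' ·)⁻¹ X} = ν_{σ⁻¹K} {T | T ∪ (σ⁻¹S₁ \ σ⁻¹K) ∈ X}`. -/
theorem cond_real_pullback (k : ℕ) (q : ℝ × ℝ) (σ : Coin ≃ Coin)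
    (hprm : ∀ i, prm k q.1 q.2 (σ i) = prm k q.1 q.2 i) (K S₁ : Set Coin) (X : Set (Set Coin)) :
    ((coinLaw k q).map (fun T : Set Coin => T ∩ K)).real
        {T | T ∪ (S₁ \ K) ∈ (fun S : Set Coin => σ ⁻¹' S) ⁻¹' X} =
      ((coinLaw k q).map (fun T : Set Coin => T ∩ σ ⁻¹' K)).real
        {T | T ∪ (σ ⁻¹' S₁ \ σ ⁻¹' K) ∈ X} := by
  have hset : {T : Set Coin | T ∪ (S₁ \ K) ∈ (fun S : Set Coin => σ ⁻¹' S) ⁻¹' X} =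
      (fun S : Set Coin => σ ⁻¹' S) ⁻¹' {T | T ∪ (σ ⁻¹' S₁ \ σ ⁻¹' K) ∈ X} := by
    ext T
    simp only [Set.mem_setOf_eq, Set.mem_preimage]
    rw [Set.preimage_union, Set.preimage_sdiff]
  rw [hset, condLaw_real_pullback k q σ hprm K]

/-- The same with the coin `i` forced ON inside: `i` becomes `σ⁻¹ i`. -/
theorem cond_real_insert_pullback (k : ℕ) (q : ℝ × ℝ) (σ : Coin ≃ Coin)
    (hprm : ∀ i, prm k q.1 q.2 (σ i) = prm k q.1 q.2 i) (K S₁ : Set Coin) (X : Set (Set Coin))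
    (i : Coin) :
    ((coinLaw k q).map (fun T : Set Coin => T ∩ K)).real
        {T | insert i (T ∪ (S₁ \ K)) ∈ (fun S : Set Coin => σ ⁻¹' S) ⁻¹' X} =
      ((coinLaw k q).map (fun T : Set Coin => T ∩ σ ⁻¹' K)).real
        {T | insert (σ.symm i) (T ∪ (σ ⁻¹' S₁ \ σ ⁻¹' K)) ∈ X} := by
  have hset : {T : Set Coin | insert i (T ∪ (S₁ \ K)) ∈ (fun S : Set Coin => σ ⁻¹' S) ⁻¹' X} =
      (fun S : Set Coin => σ ⁻¹' S) ⁻¹' {T | insert (σ.symm i) (T ∪ (σ ⁻¹' S₁ \ σ ⁻¹' K)) ∈ X} := by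
    ext T
    simp only [Set.mem_setOf_eq, Set.mem_preimage]
    rw [preimage_insert_coin, Set.preimage_union, Set.preimage_sdiff]
  rw [hset, condLaw_real_pullback k q σ hprm K]

/-- The same with the coin `i` forced OFF inside. -/
theorem cond_real_diff_pullback (k : ℕ) (q : ℝ × ℝ) (σ : Coin ≃ Coin)
    (hprm : ∀ i, prm k q.1 q.2 (σ i) = prm k q.1 q.2 i) (K S₁ : Set Coin) (X : Set (Set Coin))
    (i : Coin) :
    ((coinLaw k q).map (fun T : Set Coin => T ∩ K)).real
        {T | (T ∪ (S₁ \ K)) \ {i} ∈ (fun S : Set Coin => σ ⁻¹' S) ⁻¹' X} =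
      ((coinLaw k q).map (fun T : Set Coin => T ∩ σ ⁻¹' K)).real
        {T | (T ∪ (σ ⁻¹' S₁ \ σ ⁻¹' K)) \ {σ.symm i} ∈ X} := by
  have hset : {T : Set Coin | (T ∪ (S₁ \ K)) \ {i} ∈ (fun S : Set Coin => σ ⁻¹' S) ⁻¹' X} =
      (fun S : Set Coin => σ ⁻¹' S) ⁻¹' {T | (T ∪ (σ ⁻¹' S₁ \ σ ⁻¹' K)) \ {σ.symm i} ∈ X} := by
    ext T
    simp only [Set.mem_setOf_eq, Set.mem_preimage]
    rw [preimage_diff_singleton_coin, Set.preimage_union, Set.preimage_sdiff]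
  rw [hset, condLaw_real_pullback k q σ hprm K]

/-- **Conditional signed influences transport along an intertwined bias-preserving pair**
(ANY event `B` of bond configurations, ANY window `K` and condition `S₁`): the `ν_K`-signed
influence, condition `S₁`, of the coin `i` on the coin event of the rotated event
`{ω | g '' ω ∈ B}` equals the `ν_{σ⁻¹K}`-signed influence, condition `σ ⁻¹' S₁`, of the coin
`σ⁻¹ i` on the coin event of `B`. -/
theorem cond_infl_pullback_eq {k : ℕ} (q : ℝ × ℝ) {g : Site 2 ≃ Site 2} {σ : Coin ≃ Coin}
    (hcfg : ∀ S, BondConfig.relabel (sym2Equiv g) (cfg k S) = cfg k (σ ⁻¹' S))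
    (hprm : ∀ i, prm k q.1 q.2 (σ i) = prm k q.1 q.2 i) (K S₁ : Set Coin)
    (B : Set (BondConfig (Site 2))) (i : Coin) :
    ((coinLaw k q).map (fun T : Set Coin => T ∩ K)).real
          {T | insert i (T ∪ (S₁ \ K)) ∈ cfg k ⁻¹' (BondConfig.relabel (sym2Equiv g) ⁻¹' B)} -
        ((coinLaw k q).map (fun T : Set Coin => T ∩ K)).real
          {T | (T ∪ (S₁ \ K)) \ {i} ∈ cfg k ⁻¹' (BondConfig.relabel (sym2Equiv g) ⁻¹' B)} =
      ((coinLaw k q).map (fun T : Set Coin => T ∩ σ ⁻¹' K)).real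
          {T | insert (σ.symm i) (T ∪ (σ ⁻¹' S₁ \ σ ⁻¹' K)) ∈ cfg k ⁻¹' B} -
        ((coinLaw k q).map (fun T : Set Coin => T ∩ σ ⁻¹' K)).real
          {T | (T ∪ (σ ⁻¹' S₁ \ σ ⁻¹' K)) \ {σ.symm i} ∈ cfg k ⁻¹' B} := by
  rw [preimage_cfg_preimage_relabel hcfg, cond_real_insert_pullback k q σ hprm,
    cond_real_diff_pullback k q σ hprm]

/-- The conditional relevance-type term transports likewise:
`ν_K {T | cfg k (T ∪ (S₁ \ K)) ∈ {ω | g '' ω ∈ B}} = ν_{σ⁻¹K} {T | cfg k (T ∪ (σ⁻¹S₁ \ σ⁻¹K)) ∈ B}`. -/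
theorem cond_real_cfg_mem_pullback_eq {k : ℕ} (q : ℝ × ℝ) {g : Site 2 ≃ Site 2} {σ : Coin ≃ Coin}
    (hcfg : ∀ S, BondConfig.relabel (sym2Equiv g) (cfg k S) = cfg k (σ ⁻¹' S))
    (hprm : ∀ i, prm k q.1 q.2 (σ i) = prm k q.1 q.2 i) (K S₁ : Set Coin)
    (B : Set (BondConfig (Site 2))) :
    ((coinLaw k q).map (fun T : Set Coin => T ∩ K)).real
        {T | cfg k (T ∪ (S₁ \ K)) ∈ BondConfig.relabel (sym2Equiv g) ⁻¹' B} =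
      ((coinLaw k q).map (fun T : Set Coin => T ∩ σ ⁻¹' K)).real
        {T | cfg k (T ∪ (σ ⁻¹' S₁ \ σ ⁻¹' K)) ∈ B} := by
  have h := cond_real_pullback k q σ hprm K S₁ (cfg k ⁻¹' B)
  rw [← preimage_cfg_preimage_relabel hcfg] at h
  exact h

/-! ### The quarter turn about `k•u` -/

/-- The quarter turn fixes the block centre `k•u`. -/
theorem quarterTurn_ctr {k : ℕ} {u : Site 2} (g : Site 2 ≃ Site 2)
    (hg : ∀ x, g x = ![ctr k u 0 + ctr k u 1 - x 1, x 0 - ctr k u 0 + ctr k u 1]) :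
    g (ctr k u) = ctr k u := by
  rw [hg]
  funext i
  fin_cases i <;> simp

/-- **The coin law is invariant under the coin permutation of the quarter turn** (`k ≠ 0`). -/
theorem coinLaw_map_preimage_quarterTurn {k : ℕ} (hk : k ≠ 0) (q : ℝ × ℝ) (u : Site 2)
    (σ : Coin ≃ Coin)
    (h0 : ∀ (v : Site 2) (d : Fin 2), σ (v, d, 0) =
      (![v 1 - ctr k u 1 + ctr k u 0, ctr k u 0 + ctr k u 1 - v 0 - (if d = 0 then 1 else 0)],
        Equiv.swap 0 1 d, 0))
    (h : ∀ (t : Site 2) (d : Fin 2) (j : Fin 3), j ≠ 0 → σ (t, d, j) =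
      (![t 1 - u 1 + u 0, u 0 + u 1 - t 0 - (if d = 0 then 1 else 0)], Equiv.swap 0 1 d, j)) :
    (coinLaw k q).map (fun S : Set Coin => σ ⁻¹' S) = coinLaw k q := by
  obtain ⟨g, σ', -, h0', h', -, hprm⟩ := exists_quarterTurn hk u
  obtain rfl : σ = σ' := quarterTurn_coin_unique h0 h h0' h'
  exact coinLaw_map_preimage k q σ (hprm q.1 q.2)

/-- The conditional laws are invariant under the coin permutation of the quarter turn, up to
transporting the window: `(ν_K).map (σ ⁻¹' ·) = ν_{σ ⁻¹' K}` (`k ≠ 0`). -/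
theorem condLaw_map_pullback_quarterTurn {k : ℕ} (hk : k ≠ 0) (q : ℝ × ℝ) (u : Site 2)
    (σ : Coin ≃ Coin)
    (h0 : ∀ (v : Site 2) (d : Fin 2), σ (v, d, 0) =
      (![v 1 - ctr k u 1 + ctr k u 0, ctr k u 0 + ctr k u 1 - v 0 - (if d = 0 then 1 else 0)],
        Equiv.swap 0 1 d, 0))
    (h : ∀ (t : Site 2) (d : Fin 2) (j : Fin 3), j ≠ 0 → σ (t, d, j) =
      (![t 1 - u 1 + u 0, u 0 + u 1 - t 0 - (if d = 0 then 1 else 0)], Equiv.swap 0 1 d, j))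
    (K : Set Coin) :
    ((coinLaw k q).map (fun T : Set Coin => T ∩ K)).map (fun S : Set Coin => σ ⁻¹' S) =
      (coinLaw k q).map (fun T : Set Coin => T ∩ σ ⁻¹' K) := by
  obtain ⟨g, σ', -, h0', h', -, hprm⟩ := exists_quarterTurn hk u
  obtain rfl : σ = σ' := quarterTurn_coin_unique h0 h h0' h'
  exact coinLaw_map_inter_map_pullback k q σ (hprm q.1 q.2) K

/-- **Conditional influences are equivariant under the quarter turn about `k•u`** (`k ≠ 0`; `g`,
`σ` given by their formulas; ANY event `B`, window `K`, condition `S₁`): the `ν_K`-signed influence,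
condition `S₁`, of the coin `i` on the coin event of the rotated event `{ω | g '' ω ∈ B}` equals the
`ν_{σ⁻¹K}`-signed influence, condition `σ ⁻¹' S₁`, of the coin `σ⁻¹ i` on the coin event of `B`. -/
theorem cond_infl_quarterTurn {k : ℕ} (hk : k ≠ 0) (q : ℝ × ℝ) (u : Site 2) (g : Site 2 ≃ Site 2)
    (σ : Coin ≃ Coin) (hg : ∀ x, g x = ![ctr k u 0 + ctr k u 1 - x 1, x 0 - ctr k u 0 + ctr k u 1])
    (h0 : ∀ (v : Site 2) (d : Fin 2), σ (v, d, 0) =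
      (![v 1 - ctr k u 1 + ctr k u 0, ctr k u 0 + ctr k u 1 - v 0 - (if d = 0 then 1 else 0)],
        Equiv.swap 0 1 d, 0))
    (h : ∀ (t : Site 2) (d : Fin 2) (j : Fin 3), j ≠ 0 → σ (t, d, j) =
      (![t 1 - u 1 + u 0, u 0 + u 1 - t 0 - (if d = 0 then 1 else 0)], Equiv.swap 0 1 d, j))
    (K S₁ : Set Coin) (B : Set (BondConfig (Site 2))) (i : Coin) :
    ((coinLaw k q).map (fun T : Set Coin => T ∩ K)).real
          {T | insert i (T ∪ (S₁ \ K)) ∈ cfg k ⁻¹' (BondConfig.relabel (sym2Equiv g) ⁻¹' B)} -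
        ((coinLaw k q).map (fun T : Set Coin => T ∩ K)).real
          {T | (T ∪ (S₁ \ K)) \ {i} ∈ cfg k ⁻¹' (BondConfig.relabel (sym2Equiv g) ⁻¹' B)} =
      ((coinLaw k q).map (fun T : Set Coin => T ∩ σ ⁻¹' K)).real
          {T | insert (σ.symm i) (T ∪ (σ ⁻¹' S₁ \ σ ⁻¹' K)) ∈ cfg k ⁻¹' B} -
        ((coinLaw k q).map (fun T : Set Coin => T ∩ σ ⁻¹' K)).real
          {T | (T ∪ (σ ⁻¹' S₁ \ σ ⁻¹' K)) \ {σ.symm i} ∈ cfg k ⁻¹' B} := by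
  obtain ⟨g', σ', hg', h0', h', hcfg, hprm⟩ := exists_quarterTurn hk u
  obtain rfl : g = g' := quarterTurn_unique hg hg'
  obtain rfl : σ = σ' := quarterTurn_coin_unique h0 h h0' h'
  exact cond_infl_pullback_eq q hcfg (hprm q.1 q.2) K S₁ B i

/-- **The conditional relevance-type term under the quarter turn about `k•u`** (same setting):
`ν_K {T | cfg k (T ∪ (S₁ \ K)) ∈ {ω | g '' ω ∈ B}} = ν_{σ⁻¹K} {T | cfg k (T ∪ (σ⁻¹S₁ \ σ⁻¹K)) ∈ B}`. -/
theorem cond_real_cfg_mem_quarterTurn {k : ℕ} (hk : k ≠ 0) (q : ℝ × ℝ) (u : Site 2)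
    (g : Site 2 ≃ Site 2) (σ : Coin ≃ Coin)
    (hg : ∀ x, g x = ![ctr k u 0 + ctr k u 1 - x 1, x 0 - ctr k u 0 + ctr k u 1])
    (h0 : ∀ (v : Site 2) (d : Fin 2), σ (v, d, 0) =
      (![v 1 - ctr k u 1 + ctr k u 0, ctr k u 0 + ctr k u 1 - v 0 - (if d = 0 then 1 else 0)],
        Equiv.swap 0 1 d, 0))
    (h : ∀ (t : Site 2) (d : Fin 2) (j : Fin 3), j ≠ 0 → σ (t, d, j) =
      (![t 1 - u 1 + u 0, u 0 + u 1 - t 0 - (if d = 0 then 1 else 0)], Equiv.swap 0 1 d, j))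
    (K S₁ : Set Coin) (B : Set (BondConfig (Site 2))) :
    ((coinLaw k q).map (fun T : Set Coin => T ∩ K)).real
        {T | cfg k (T ∪ (S₁ \ K)) ∈ BondConfig.relabel (sym2Equiv g) ⁻¹' B} =
      ((coinLaw k q).map (fun T : Set Coin => T ∩ σ ⁻¹' K)).real
        {T | cfg k (T ∪ (σ ⁻¹' S₁ \ σ ⁻¹' K)) ∈ B} := by
  obtain ⟨g', σ', hg', h0', h', hcfg, hprm⟩ := exists_quarterTurn hk u
  obtain rfl : g = g' := quarterTurn_unique hg hg'
  obtain rfl : σ = σ' := quarterTurn_coin_unique h0 h h0' h'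
  exact cond_real_cfg_mem_pullback_eq q hcfg (hprm q.1 q.2) K S₁ B

end Summit.CriticalPhenomena.CardyFormulaZ2.Theorems.CardySelfRefinement.FarField

end
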